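import Summits.HodgeConjecture.CorCM.B01.Transposition.Item6CentralTypeAtPinCanonical
import Summits.HodgeConjecture.CorCM.D2Bridge.IndexInhabited
import Literature.NumberTheory.Automorphic.UnitaryGroupAdelicCharactersDet
import Literature.NumberTheory.Automorphic.RelNormOneTorusArchDivisible
import Literature.NumberTheory.Automorphic.UnitaryGroupArchCenter
import Literature.NumberTheory.Weil1964.AdelicMetaplecticTwistCharacter
import Literature.NumberTheory.GelbartRogawski1991.UnitaryDualPairThetaKernelTwist
import HarnessLib

/-!
# FLOOR-0 P4 — GUARD for the `conjugate` branch: at a NON-canonical `ι₁` the pinned Liu index is EMPTY (no continuity hypothesis)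

Cell hodgecm-mathlib (D-0151), FLOOR 0, crux item H413 = stmt-HodgeConjecture-24833; programme P4, line
`Cruxes/H413/Lines/F0_P4AdmissibleOccursInH1.lean` (F0P4-plan (g0)); F0P4-plan 2026-08-30T21:47:47Z (3) «ONE GUARD for the `conjugate`
branch».  Author F0P4-p08 (g0).  `--supports stmt-HodgeConjecture-24833` (helper; closes no registered stub by itself).

Every P4 stub (`StubT2aHolClassMapAt`, …, `StubT3aHolThetaRealisationOfRallisAt`, `StubT3bConjugatePartnerAt`, and `HoccType` itself) binds
an index `i : I V (repAt a₀) (muLiu ι₁ GramClass.rep)` of the pin.  The model's archimedean layer (`harm_lineOmega_zeroG`, …) carries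
`hemb : (InfinitePlace.mk ι₁).embedding = ι₁`.  ★ `CentralTypeAtPin.embedding_mk_eq_of_continuous_indexOfRecord` derives `hemb` from a
CONTINUOUS index line; but the index `I V ρ μ` admits ARBITRARY compatible pair splittings ([GelbartRogawski1991, Prop. 3.1.1]'s
`IsCompatible` carries no topology), so that theorem does not make the `¬ hemb` world vacuous.  THIS FILE removes the continuity hypothesis:

* §1 **`exists_nsmul_eq_sub_of_hasCentralTypeAt`** — for ANY two compatible pair splittings `s₀`, `s` of the CM see-saw datum of the line
  `⟨a⟩` over the frame of `V` (rank `3 × 1`), with archimedean central types `m₀`, `m` (★ `LiuIndex.HasCentralTypeAt`), `3 ∣ (m − m₀)`: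
  `∃ k, 3 • k = m − m₀`.  Proof: `s = s₀ ⊗ η` for an ABSTRACT scalar character `η` of the pair group (★ `adelicMpCont.exists_eq_twist`, no
  continuity); on the archimedean centre `(t · 1_V, 1)` the two central-type equations give `η = archWeight (m − m₀)` (continuous!); the
  restriction of `η` to `U(V)(L⁺ ⊗ ℝ)` kills every element all of whose complex components have determinant one — the ABSTRACT perfectness
  `U(p,q)′ = SU(p,q)` at each complex place, ★ `AdelicCharactersDet.arch_apply_eq_one` ([Dieudonne1971GroupesClassiques, Chap. II §5]) — so by
  the divisible-torus factorisation ★ `UnitaryGroup.exists_continuous_comp_cmArchDet_eq'` it is `α ∘ det_∞` with `α` CONTINUOUS on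
  `U(1)(L⁺ ⊗ ℝ)`, `α = archWeight k` (★ `existsUnique_archWeight_eq`), and `det_∞ (t · 1_V) = t ^ 3` (★ `cmArchDet_cmArchCenter`) gives
  `archWeight (m − m₀) = archWeight (3 • k)`.  (This is [GelbartRogawski1991, §3.1 Remark p. 457 L9–13] «`s* = s ⊗ ν′`, `ν′` a character of
  `E¹` through `det`» read on the archimedean centre only, for abstract `s*`.)
* §2 **`embedding_mk_eq_of_index`** — hence EVERY index `i : I V ρ (muLiu ι₁ ρ')` (`ρ`, `ρ'` sections of `mk`) forces
  `(mk ι₁).embedding = ι₁` (the exponent equation of §1 against the weight-one base point `ι_{μ₀}` of `Φ^δ(ρ i.1)`, ★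
  `hasCentralTypeAt_chiSplittingLine_toHeckeCharacter_weightOneType`, and the arithmetic of ★ `embedding_mk_eq_of_continuous`: at a non-canonical
  `ι₁` the right-hand side at `w₁` is `±2`); **`isEmpty_index_of_embedding_mk_ne`**.
* §3 at the index of record: **`isEmpty_indexOfRecord_of_embedding_mk_ne`** —
  `(mk ι₁).embedding ≠ ι₁ → IsEmpty (I V (repAt a₀) (muLiu ι₁ GramClass.rep))`; with ★ `IndexInhabited.nonempty_index` the DECISION
  **`nonempty_indexOfRecord_iff`** — `Nonempty (I V (repAt a₀) (muLiu ι₁ GramClass.rep)) ↔ (mk ι₁).embedding = ι₁`; and the consumer shape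
  **`forall_indexOfRecord_of_embedding_mk_ne`** — at a non-canonical `ι₁` every statement `∀ i : I V (repAt a₀) (muLiu ι₁ GramClass.rep), P i` holds.

CONSEQUENCE FOR THE LINE (recorded, not a theorem of this file): the node `StubT3aHolThetaRealisationAt` (and every other P4 stub) needs the
master statement UNDER `hemb` ONLY; in the branch `(mk ι₁).embedding = conjugate ι₁` it closes by `(isEmpty_indexOfRecord_of_embedding_mk_ne …).elim i`.
KERNEL only: theorems, no definition, no named fact, no `sorry`.  HC_CM is proved only modulo the printed citations until rung 0 closes; this
file proves nothing about them.

## References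
* [GelbartRogawski1991] S. Gelbart, J. Rogawski, *L-functions and Fourier–Jacobi coefficients for the unitary group U(3)*, Invent. Math.
  105 (1991), §3.1 Prop. 3.1.1 p. 455, Remark p. 457 L4–13.
* [Dieudonne1971GroupesClassiques] J. Dieudonné, *La géométrie des groupes classiques*, 3e éd. (1971), Chap. II §5.
* [Bourbaki1995] N. Bourbaki, *General Topology, Chapters 1–4* (1995), Ch. I §3 no. 4 Prop. 6.
* [Liu2021] Y. Liu, *Fourier–Jacobi cycles and arithmetic relative trace formula*, Camb. J. Math. 9 (2021), Def. 4.12, App. D Lem. D.2.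
* Tree: ★ `CorCM/B01/Transposition/Item6CentralTypeAtPinCanonical` (`embedding_mk_eq_of_continuous`), ★ `Item6CentralTypeAtPin`
  (`centralType_weightOneType_of_deltaPos`, `hasCentralTypeAt_chiSplittingLine_toHeckeCharacter_weightOneType`), ★ `HodgeCM/Model/LiuIndexCentralType_1`
  (`HasCentralTypeAt`, `I`), ★ `CorCM/D2Bridge/IndexInhabited` (`nonempty_index`), ★ `Automorphic/UnitaryGroupAdelicCharactersDet`
  (`arch_apply_eq_one`), ★ `Automorphic/RelNormOneTorusArchDivisible` (`exists_continuous_comp_cmArchDet_eq'`, `cmArchDet_cmArchCenter`),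
  ★ `Automorphic/UnitaryGroupArchCenter` (`archToAdelic_cmArchCenter`), ★ `Weil1964/AdelicMetaplecticTwistCharacter` (`adelicMpCont.exists_eq_twist`),
  ★ `GelbartRogawski1991/UnitaryDualPairThetaKernelTwist` (`pairRep_twist_apply`, `pairMap_apply`).
-/

set_option autoImplicit false
set_option linter.dupNamespace false

noncomputable section

namespace Summit.HodgeConjecture.HodgeConjecture.Cruxes.H413.IndexOrientation

open NumberField NumberField.InfinitePlace NumberField.mixedEmbedding IsDedekindDomain
open scoped Matrix SchwartzMap Classical TensorProduct
open Literature.NumberTheory.Automorphic Literature.NumberTheory.Automorphic.UnitaryGroup Literature.NumberTheory.Weil1964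
open Literature.NumberTheory.GelbartRogawski1991 Literature.NumberTheory.GelbartRogawski1991.UnitaryDualPair
open Literature.NumberTheory.GelbartRogawski1991.GRConstruction
open Literature.NumberTheory.Automorphic.Liu2021.Def411WeilCarriersDoubling
open Literature.NumberTheory.Automorphic.IdeleClassGroup
open Literature.NumberTheory.GaloisRepresentations
open Literature.RepresentationTheory.HarrisKudlaSweet1996
open HodgeCM HodgeCM.Model HodgeCM.Model.LiuIndex
open HodgeCM.SignRecipe (lineType mem_lineType_iff eta_eq_imagUnit)
open HodgeCM.Model.ArchSideTerm (e₁)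
open HodgeCM.Model.SupplyInstance (testFun)
open Summit.HodgeConjecture.CorCM.Transposition.CentralTypeAtPin

variable {L : CMField} {ι₁ : (L : Type) →+* ℂ} (V : HermSpace3 L ι₁)

/-! ## §1 The archimedean exponent congruence for two ARBITRARY compatible pair splittings -/

/-- `det (diagonal (frameD V)) ≠ 0`. [folklore] -/
private theorem det_diagonal_frameD_ne_zero : (Matrix.diagonal (frameD V)).det ≠ 0 := by
  rw [Matrix.det_diagonal]
  exact Finset.prod_ne_zero_iff.2 fun i _ => frameD_ne V i

set_option maxHeartbeats 4000000 in
/-- **`3 ∣ (m − m₀)` for the central types of ANY two compatible pair splittings** of the CM see-saw datum of the line `⟨a⟩` over the frame of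
`V`: if `s₀`, `s : SplittingAt V a` are compatible ([GelbartRogawski1991, Prop. 3.1.1], NO continuity assumed) of archimedean central types
`m₀`, `m`, then `3 • k = m − m₀` for some `k`.  The twist `η = s ∕ s₀` is an abstract scalar character of the pair group; its restriction
to `U(V)(L⁺ ⊗ ℝ)` kills the determinant-one elements place by place (`U(p,q)′ = SU(p,q)` abstractly, [Dieudonne1971GroupesClassiques, Chap. II §5])
and is continuous on the centre (it is `archWeight (m − m₀)` there), hence `α ∘ det_∞` with `α = archWeight k` continuous; `det_∞ (t · 1_V) = t³`.
[cite: GelbartRogawski1991, §3.1 Remark p. 457 L9–13] [cite: Dieudonne1971GroupesClassiques, Chap. II §5] [cite: Bourbaki1995, Ch. I §3 no. 4 Prop. 6] -/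
theorem exists_nsmul_eq_sub_of_hasCentralTypeAt (a : RealScalar L) {s₀ s : SplittingAt V a}
    (hs₀ : IsCompatAtScalar V a s₀) (hs : IsCompatAtScalar V a s) {m₀ m : InfinitePlace (L : Type) → ℤ}
    (h₀ : HasCentralTypeAt V a s₀ m₀) (h : HasCentralTypeAt V a s m) :
    ∃ k : InfinitePlace (L : Type) → ℤ, 3 • k = m - m₀ := by
  -- (1) `s = s₀ ⊗ η` for an abstract scalar character `η` of the pair group
  obtain ⟨η, hη⟩ := adelicMpCont.exists_eq_twist s₀ s
    (isUnit_adelicGram (↥(maximalRealSubfield (L : Type))) e₁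
      (isUnit_det_realDiagonal (L : Type) (frameD V) (frameD_real V) (frameD_ne V))
      (isUnit_det_realDiagonal (L : Type) (RealScalar.vec a) (RealScalar.vec_real a) (RealScalar.vec_ne a)))
    (fun g => (hs₀.1 g).trans (hs.1 g).symm)
  -- (2) on the archimedean centre `(t · 1_V, 1)`: `η = archWeight (m − m₀)`
  obtain ⟨x₀, hx₀⟩ := exists_testFun_gaussianAt_ne_zero V a
  have hcen : ∀ t : ↥(Literature.NumberTheory.Automorphic.relNormOneInfUnits (↥(maximalRealSubfield (L : Type))) (L : Type)),
      ((η (pairMap (↥(maximalRealSubfield (L : Type))) (L : Type) (IsCMField.complexConj (L : Type)) 3 1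
          (Matrix.diagonal (frameD V)) (Matrix.diagonal (RealScalar.vec a))
          (CMCenter (L : Type) (frameD V) (archUnit (L : Type) t), 1)) : ℂˣ) : ℂ) =
        Literature.NumberTheory.Automorphic.archWeight (L : Type) (m - m₀) t := by
    intro t
    have e1 := h t x₀ 1
    have e0 := h₀ t x₀ 1
    rw [hη, pairRep_twist_apply, e0, smul_smul] at e1
    have e2 : ((η (pairMap (↥(maximalRealSubfield (L : Type))) (L : Type) (IsCMField.complexConj (L : Type)) 3 1
          (Matrix.diagonal (frameD V)) (Matrix.diagonal (RealScalar.vec a))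
          (CMCenter (L : Type) (frameD V) (archUnit (L : Type) t), 1)) : ℂˣ) : ℂ) * Literature.NumberTheory.Automorphic.archWeight (L : Type) m₀ t =
        Literature.NumberTheory.Automorphic.archWeight (L : Type) m t := smul_left_injective ℂ hx₀ e1
    have hne : Literature.NumberTheory.Automorphic.archWeight (L : Type) m₀ t ≠ 0 :=
      norm_ne_zero_iff.mp (by rw [Literature.NumberTheory.Automorphic.norm_archWeight]; exact one_ne_zero)
    rw [archWeight_sub, ← e2, mul_div_cancel_right₀ _ hne]
  -- (3) the restriction of `η` to `U(V)(L⁺ ⊗ ℝ)`, as a `ℂ`-valued character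
  let θ : ↥(UnitaryGroup.arch (↥(maximalRealSubfield (L : Type))) (L : Type) (IsCMField.complexConj (L : Type)) 3
      (Matrix.diagonal (frameD V))) →* ℂˣ :=
    η.comp ((UnitaryGroup.adelicInl (↥(maximalRealSubfield (L : Type))) (L : Type) (IsCMField.complexConj (L : Type)) 3 1
      (Matrix.diagonal (frameD V)) (Matrix.diagonal (RealScalar.vec a))).comp
      (UnitaryGroup.archToAdelic (↥(maximalRealSubfield (L : Type))) (L : Type) (IsCMField.complexConj (L : Type)) 3
        (Matrix.diagonal (frameD V))))
  let χ' : ↥(UnitaryGroup.arch (↥(maximalRealSubfield (L : Type))) (L : Type) (IsCMField.complexConj (L : Type)) 3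
      (Matrix.diagonal (frameD V))) →* ℂ := (Units.coeHom ℂ).comp θ
  -- its value on the centre
  have hχ'cen : ∀ y, χ' (UnitaryGroup.cmArchCenter (L : Type) 3 (Matrix.diagonal (frameD V)) y) = Literature.NumberTheory.Automorphic.archWeight (L : Type) (m - m₀) y := by
    intro y
    rw [← hcen y]
    show (((η (UnitaryGroup.adelicInl (↥(maximalRealSubfield (L : Type))) (L : Type) (IsCMField.complexConj (L : Type)) 3 1
        (Matrix.diagonal (frameD V)) (Matrix.diagonal (RealScalar.vec a))
        (UnitaryGroup.archToAdelic (↥(maximalRealSubfield (L : Type))) (L : Type) (IsCMField.complexConj (L : Type)) 3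
          (Matrix.diagonal (frameD V)) (UnitaryGroup.cmArchCenter (L : Type) 3 (Matrix.diagonal (frameD V)) y)))) : ℂˣ) : ℂ) = _
    rw [UnitaryGroup.archToAdelic_cmArchCenter, pairMap_apply, map_one, mul_one]
  -- it kills the archimedean elements all of whose complex components have determinant one (abstract perfectness, place by place)
  have hSU : ∀ g : ↥(UnitaryGroup.arch (↥(maximalRealSubfield (L : Type))) (L : Type) (IsCMField.complexConj (L : Type)) 3
      (Matrix.diagonal (frameD V))),
      (∀ w : {w : InfinitePlace (L : Type) // IsComplex w},
        (((UnitaryGroup.archPiEquivCM 3 (L : Type) (Matrix.diagonal (frameD V)) g w :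
            UnitaryGroup.archLocal (L : Type) 3 (Matrix.diagonal (frameD V)) w) : GL (Fin 3) ℂ) : Matrix (Fin 3) (Fin 3) ℂ).det = 1) →
      χ' g = 1 := by
    intro g hg
    show (((θ g : ℂˣ)) : ℂ) = 1
    rw [AdelicCharactersDet.arch_apply_eq_one (L : Type) (frameD V) (frameD_real V) (frameD_ne V) θ g hg, Units.val_one]
  -- and it is continuous on the centre
  have hcont : Continuous fun y => χ' (UnitaryGroup.cmArchCenter (L : Type) 3 (Matrix.diagonal (frameD V)) y) := by
    have heq : (fun y => χ' (UnitaryGroup.cmArchCenter (L : Type) 3 (Matrix.diagonal (frameD V)) y)) =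
        fun y => Literature.NumberTheory.Automorphic.archWeight (L : Type) (m - m₀) y := funext hχ'cen
    rw [heq]
    exact Literature.NumberTheory.Automorphic.continuous_archWeight (L : Type) (m - m₀)
  -- (4) hence `χ' = α ∘ det_∞` with `α` continuous, `α = archWeight k`
  obtain ⟨α, hα, hfac⟩ := UnitaryGroup.exists_continuous_comp_cmArchDet_eq' (L : Type) 3 (Matrix.diagonal (frameD V))
    (det_diagonal_frameD_ne_zero V) three_ne_zero χ' hSU hcont
  obtain ⟨k, hk, -⟩ := Literature.NumberTheory.Automorphic.existsUnique_archWeight_eq (L : Type) α hα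
  refine ⟨k, Literature.NumberTheory.Automorphic.archWeight_injective (MonoidHom.ext fun t => ?_)⟩
  -- `archWeight (3 • k) t = (α t)^3 = α (det_∞ (t · 1_V)) = χ' (t · 1_V) = archWeight (m − m₀) t`
  rw [archWeight_nsmul, hk, ← map_pow, ← UnitaryGroup.cmArchDet_cmArchCenter (L : Type) 3 (Matrix.diagonal (frameD V))
    (det_diagonal_frameD_ne_zero V) t, ← hχ'cen t, hfac, MonoidHom.comp_apply]

/-! ## §2 Every index line forces the canonical embedding — no continuity hypothesis -/

variable (ρ ρ' : GramClass L → RealScalar L)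

set_option maxHeartbeats 4000000 in
/-- **`3 • k = muLiu ι₁ ρ' i.1 − centralType (weightOneType Φ^δ(ρ i.1))`** for EVERY index `i : I V ρ (muLiu ι₁ ρ')` (`ρ` a section of `mk`;
NO continuity of the pair splitting): §1 against the weight-one base point `ι_{μ₀}` of `Φ^δ(ρ i.1)` ([WeilBNT1967, VII §3] existence, ★
`exists_isConjugateSymplectic_hasCMType`; its central type ★ `hasCentralTypeAt_chiSplittingLine_toHeckeCharacter_weightOneType`).
[cite: GelbartRogawski1991, §3.1 Remark p. 457 L9–13] [cite: Liu2021, App. D §D.1 Step 2 (l. 5219)] -/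
theorem exists_nsmul_eq_muLiu_sub_centralType_of_index (hρ : ∀ q, GramClass.mk (ρ q) = q) (i : I V ρ (muLiu ι₁ ρ')) :
    ∃ k : InfinitePlace (L : Type) → ℤ,
      3 • k = muLiu ι₁ ρ' i.1 -
        centralType (L : Type) e₁ (frameD V) (frameD_real V) (RealScalar.vec (ρ i.1)) (RealScalar.vec_real (ρ i.1))
          (weightOneType (L : Type) (lineType (ρ i.1).1 (ρ i.1).2.1 (ρ i.1).2.2)) := by
  obtain ⟨μ₀, hμ₀, hw, hΦμ⟩ := exists_isConjugateSymplectic_hasCMType (L := (L : Type)) (lineType (ρ i.1).1 (ρ i.1).2.1 (ρ i.1).2.2)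
  exact exists_nsmul_eq_sub_of_hasCentralTypeAt V (ρ i.1)
    (isCompatible_chiSplittingLine (L : Type) e₁ (frameD V) (frameD_real V) (frameD_ne V) (toHeckeCharacter (L : Type) μ₀)
      (isUnitary_toHeckeCharacter (L : Type) μ₀) (isSplittingChar_toHeckeCharacter_of_isConjugateSymplectic (L : Type) μ₀ hμ₀)
      (realDiagonal (L : Type) (RealScalar.vec (ρ i.1)) (RealScalar.vec_real (ρ i.1)))
      (realDiagonal_isSymm (L : Type) (RealScalar.vec (ρ i.1)) (RealScalar.vec_real (ρ i.1)))
      (isUnit_det_realDiagonal (L : Type) (RealScalar.vec (ρ i.1)) (RealScalar.vec_real (ρ i.1)) (RealScalar.vec_ne (ρ i.1)))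
      (Matrix.diagonal (RealScalar.vec (ρ i.1))) (realDiagonal_map (L : Type) (RealScalar.vec (ρ i.1)) (RealScalar.vec_real (ρ i.1))).symm)
    (isCompatAt_of_mem V ρ _ i) (hasCentralTypeAt_chiSplittingLine_toHeckeCharacter_weightOneType V (ρ i.1) μ₀ hμ₀ hw hΦμ)
    (hasCentralTypeAt_of_mem' V hρ (muLiu ι₁ ρ') i)

set_option maxHeartbeats 4000000 in
/-- **EVERY INDEX LINE FORCES `(mk ι₁).embedding = ι₁`** (`ρ`, `ρ'` sections of `mk`; NO continuity): otherwise `(mk ι₁).embedding = ῑ₁`, the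
table `muLiu ι₁ ρ' i.1 = ∓𝟙_{w₁}` (sign: `ι₁ ∈ Φ^δ`) and the central type `centralType (weightOneType Φ^δ) = ∓𝟙_{w₁}` (sign: `ῑ₁ ∈ Φ^δ`, ★
`centralType_weightOneType_of_deltaPos`) are negatives of each other, so the exponent equation reads `3 k_{w₁} = ±2` — impossible (the arithmetic
of ★ `embedding_mk_eq_of_continuous`, verbatim). [cite: GelbartRogawski1991, §3.1 Remark p. 457 L9–13] [cite: KonnoKonno2007, Lemma 5.2 p. 73]
[cite: Liu2021, Def. 4.12, App. D Lem. D.2] -/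
theorem embedding_mk_eq_of_index (hρ : ∀ q, GramClass.mk (ρ q) = q) (hρ' : ∀ q, GramClass.mk (ρ' q) = q)
    (i : I V ρ (muLiu ι₁ ρ')) : (InfinitePlace.mk ι₁).embedding = ι₁ := by
  obtain ⟨k, hk⟩ := exists_nsmul_eq_muLiu_sub_centralType_of_index V ρ ρ' hρ i
  set Φ := lineType (ρ i.1).1 (ρ i.1).2.1 (ρ i.1).2.2 with hΦdef
  have hΦ : ∀ φ : (L : Type) →+* ℂ, φ ∈ Φ.1 ↔ 0 < (φ (imagUnit (L : Type) * (ρ i.1).1)).im := fun φ => by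
    rw [hΦdef, mem_lineType_iff, eta_eq_imagUnit]
  have hw₁ : (cmPlaceOver (L : Type) (HypCensus.cmPlace (L : Type) ι₁)).1 = InfinitePlace.mk ι₁ :=
    cmPlaceOver_eq_mk (L : Type) _ ι₁ rfl
  -- the exponent equation at the place `w₁ = mk ι₁`
  have hk₁ := congr_fun hk (InfinitePlace.mk ι₁)
  simp only [Pi.smul_apply, Pi.sub_apply, nsmul_eq_mul, Nat.cast_ofNat] at hk₁
  -- the table at `w₁`: `∓1` as `ι₁ ∈ Φ^δ`
  have hm : muLiu ι₁ ρ' i.1 (InfinitePlace.mk ι₁) = if ι₁ ∈ Φ.1 then -1 else 1 := by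
    have e1 : muLiu ι₁ ρ' i.1 = muLiu ι₁ ρ' (GramClass.mk (ρ i.1)) := by rw [hρ i.1]
    rw [e1, muLiu_mk hρ' (ρ i.1)]
    unfold placeIndicator
    rw [hw₁]
    split_ifs <;> simp
  -- the central type at `w₁`: `∓1` as `w₁.embedding ∈ Φ^δ`
  have hc : centralType (L : Type) e₁ (frameD V) (frameD_real V) (RealScalar.vec (ρ i.1)) (RealScalar.vec_real (ρ i.1))
      (weightOneType (L : Type) Φ) (InfinitePlace.mk ι₁) = if (InfinitePlace.mk ι₁).embedding ∈ Φ.1 then -1 else 1 := by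
    rw [centralType_weightOneType_of_deltaPos V (ρ i.1) Φ hΦ]
    split_ifs <;> simp
  rw [hm, hc] at hk₁
  by_contra hne
  have hconj : (InfinitePlace.mk ι₁).embedding = ComplexEmbedding.conjugate ι₁ := (embedding_mk_eq ι₁).resolve_left hne
  by_cases hι : ι₁ ∈ Φ.1
  · have hnot : (InfinitePlace.mk ι₁).embedding ∉ Φ.1 := by
      rw [hconj]
      exact (Φ.2 ι₁).1 hι
    rw [if_pos hι, if_neg hnot] at hk₁
    omega
  · have hmem : (InfinitePlace.mk ι₁).embedding ∈ Φ.1 := by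
      rw [hconj]
      by_contra h2
      exact hι ((Φ.2 ι₁).2 h2)
    rw [if_neg hι, if_pos hmem] at hk₁
    omega

/-- **At a NON-canonical `ι₁` the index `I V ρ (muLiu ι₁ ρ')` is EMPTY** (`ρ`, `ρ'` sections of `mk`).
[cite: GelbartRogawski1991, §3.1 Remark p. 457 L9–13] [cite: Liu2021, Def. 4.12] -/
theorem isEmpty_index_of_embedding_mk_ne (hρ : ∀ q, GramClass.mk (ρ q) = q) (hρ' : ∀ q, GramClass.mk (ρ' q) = q)
    (hne : (InfinitePlace.mk ι₁).embedding ≠ ι₁) : IsEmpty (I V ρ (muLiu ι₁ ρ')) :=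
  ⟨fun i => hne (embedding_mk_eq_of_index V ρ ρ' hρ hρ' i)⟩

/-! ## §3 At the index of record `I V (repAt a₀) (muLiu ι₁ GramClass.rep)` (the binder of every P4 stub and of `HoccType`) -/

/-- at the index of record, ANY index (continuous or not) forces the canonical embedding.
[cite: GelbartRogawski1991, §3.1 Remark p. 457 L9–13] [cite: Liu2021, Def. 4.12] -/
theorem embedding_mk_eq_of_indexOfRecord (a₀ : RealScalar L) (i : I V (repAt a₀) (muLiu ι₁ GramClass.rep)) :
    (InfinitePlace.mk ι₁).embedding = ι₁ :=
  embedding_mk_eq_of_index V (repAt a₀) GramClass.rep (fun q => repAt_spec a₀ q) GramClass.mk_rep i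

/-- **THE GUARD: at a NON-canonical `ι₁` the index of record is EMPTY** — `(mk ι₁).embedding ≠ ι₁ → IsEmpty (I V (repAt a₀) (muLiu ι₁ GramClass.rep))`.
[cite: GelbartRogawski1991, §3.1 Remark p. 457 L9–13] [cite: Liu2021, Def. 4.12] -/
theorem isEmpty_indexOfRecord_of_embedding_mk_ne (a₀ : RealScalar L) (hne : (InfinitePlace.mk ι₁).embedding ≠ ι₁) :
    IsEmpty (I V (repAt a₀) (muLiu ι₁ GramClass.rep)) :=
  isEmpty_index_of_embedding_mk_ne V (repAt a₀) GramClass.rep (fun q => repAt_spec a₀ q) GramClass.mk_rep hne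

/-- **THE DECISION**: the index of record is inhabited iff `ι₁` is the canonical embedding of its place (`⇐`: ★ `IndexInhabited.nonempty_index`,
[WeilBNT1967, VII §3]; `⇒`: §2). [cite: GelbartRogawski1991, §3.1 Remark p. 457 L9–13] [cite: WeilBNT1967, Ch. VII §3] [cite: Liu2021, Def. 4.12] -/
theorem nonempty_indexOfRecord_iff (a₀ : RealScalar L) :
    Nonempty (I V (repAt a₀) (muLiu ι₁ GramClass.rep)) ↔ (InfinitePlace.mk ι₁).embedding = ι₁ :=
  ⟨fun ⟨i⟩ => embedding_mk_eq_of_indexOfRecord V a₀ i,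
    fun hemb => Summit.HodgeConjecture.CorCM.D2Bridge.IndexInhabited.nonempty_index V hemb a₀⟩

/-- **consumer shape**: at a non-canonical `ι₁` every statement quantified over the index of record holds vacuously (the `conjugate` branch of the
P4 node `StubT3aHolThetaRealisationAt` and of every P4 stub). [cite: Liu2021, Def. 4.12] -/
theorem forall_indexOfRecord_of_embedding_mk_ne (a₀ : RealScalar L) (hne : (InfinitePlace.mk ι₁).embedding ≠ ι₁)
    {P : I V (repAt a₀) (muLiu ι₁ GramClass.rep) → Prop} (i : I V (repAt a₀) (muLiu ι₁ GramClass.rep)) : P i :=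
  (isEmpty_indexOfRecord_of_embedding_mk_ne V a₀ hne).elim i

/-- **dichotomy for the consumer**: for every index of record, either `(mk ι₁).embedding = ι₁` (and the `hemb`-world theorems apply) — the other
case `(mk ι₁).embedding = conjugate ι₁` (★ `NumberField.InfinitePlace.embedding_mk_eq`) cannot occur. [cite: Liu2021, Def. 4.12] -/
theorem embedding_mk_ne_conjugate_of_indexOfRecord (a₀ : RealScalar L) (i : I V (repAt a₀) (muLiu ι₁ GramClass.rep)) :
    (InfinitePlace.mk ι₁).embedding ≠ ComplexEmbedding.conjugate ι₁ := by
  intro h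
  have h1 := embedding_mk_eq_of_indexOfRecord V a₀ i
  rw [h1] at h
  -- `ι₁ = conjugate ι₁` would make `mk ι₁` real, but `L` is totally complex
  have hreal : ComplexEmbedding.IsReal ι₁ := by
    rw [ComplexEmbedding.isReal_iff]; exact h.symm
  exact (InfinitePlace.not_isReal_iff_isComplex.2 (IsTotallyComplex.isComplex (InfinitePlace.mk ι₁)))
    (InfinitePlace.isReal_iff.2 (by rwa [InfinitePlace.embedding_mk_eq_of_isReal hreal]))

end Summit.HodgeConjecture.HodgeConjecture.Cruxes.H413.IndexOrientation

end
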